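import Summits.Schanuel.Schanuel.Theorems.DiophantineDichotomyDefs
import Summits.Schanuel.Schanuel.Theorems.DiophantineDichotomyKhovanskiiApproxTypePenaltyTransfer
import Summits.Schanuel.Schanuel.Theorems.DiophantineDichotomyKhovanskiiApproxTypePenaltySlotDichotomyTwo
import Literature.NumberTheory.Transcendental.LindemannWeierstrassMeasure

/-!
# The Lindemann–Weierstrass layer of `KhovanskiiApproxType` / `KhovanskiiApproxTypeEv` from the
# printed theorem of Ably (1994)

Route `DiophantineDichotomy` (sub-problem `Schanuel/Schanuel`); items `KhovanskiiApproxType`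
(stmt-Schanuel-6116, all heights) and `KhovanskiiApproxTypeEv` (stmt-Schanuel-14972, eventual in
the height); line `height-window-compactness` of 6116 (skeleton
`Cruxes/KhovanskiiApproxType/Lines/height_window_compactness.lean`, vocabulary
`Theorems/DiophantineDichotomyDefs.lean`, namespace `…KhovanskiiApproxType.HeightWindowCompactness`).

What is proved here (no `sorry`, no new definition; ONE named fact is CONSUMED as a hypothesis:
`Literature.NumberTheory.Transcendental.Ably1994_lindemannWeierstrass_measure`, Ably 1994,
Acta Arith. 67, Théorème p. 30, vendored in `Literature/NumberTheory/Transcendental/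
LindemannWeierstrassMeasure.lean`):

* `lwPenaltyMeasure_of_ably` — the named fact gives the registered stub statement
  `LWPenaltyMeasure` (stub 1 of the line): Ably's `−c₂ Dᵐ (log H + exp(C Dᵐ log(D+1)))` at
  `D = max 1 (deg P)`, `H = max 1 (height P)` is `≥ −(c₂ Dᵐ log H + exp(κ Dᵐ log(D+2)))` with
  `κ = |log c₂| + m + C` (`c₂ Dᵐ ≤ exp((|log c₂| + m) Dᵐ log(D+2))` since `log 3 ≥ 1`).
* `approxTypePenAt_two_of_lwPenaltyMeasure` — stub 1 (`LWPenaltyMeasure`) and the LANDED stubs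
  2–3 of the line (`stub_penaltyTransfer` p85905, `stub_penaltySlotDichotomy_two` p94631) give the
  PENALTY FORM of the crux `ApproxTypePenAt 2 s a κ C`, `a < 1`, at every Lindemann–Weierstrass
  point `s ∈ ℚ̄²` with `ℚ`-linearly independent coordinates (the skeleton's
  `approxTypePenAt_two_of_LW` with stubs 2–3 discharged).
* `evAt_two_of_pen` — the penalty form implies the EVENTUAL-in-the-height typed bound (the shape
  of `KhovanskiiApproxTypeEv` at the point) with threshold `H₀(d) = ⌈exp(exp(κ d log(d+2)))⌉`:
  above it the penalty is `≤ log H ≤ d^{a⁺} log H` and is absorbed by `C ↦ C + 1`.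
* `evLW_two_of_ably` — **the `n = 2` Lindemann–Weierstrass layer of the crux
  `KhovanskiiApproxTypeEv`, conditional ONLY on the cited theorem of Ably** (named fact, being
  discharged in `Literature/NumberTheory/Transcendental/LWMeasure*.lean`): at every `s ∈ ℚ̄²`
  with `ℚ`-linearly independent coordinates, `∃ a < 1, b, C > 0, ∀ d ∃ H₀ ∀ H ≥ H₀`, every
  algebraic challenger `γ` of level `(d, H)` has `‖γ − (s, e^s)‖ ≥ exp(−C(dᵃ log H + dᵇ))` —
  the first free Khovanskii points at which the conclusion of the route's load-bearing crux is
  reduced to one printed theorem, kernel-checked.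

Not here: the height WINDOW and the small-height FLOOR of the all-heights item 6116 (stubs 4–5 of
the line) and the composition of 6116 from them (file
`DiophantineDichotomyKhovanskiiApproxTypeWindowComposition.lean`), anything off the LW layer
(stubs 6–7).
-/

noncomputable section

-- `Summit.Schanuel.Schanuel.…` is the mandated summit/sub-problem namespace (single-conjunct summit), hence:
set_option linter.dupNamespace false

namespace Summit.Schanuel.Schanuel.Cruxes.KhovanskiiApproxType.HeightWindowCompactness

open Summit.Schanuel.Schanuel.Cruxes.KhovanskiiApproxType.LwSmallHeight
open Literature.NumberTheory.Transcendental (Ably1994_lindemannWeierstrass_measure)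
open Polynomial

namespace LWLayerPrinted

/-! ## Bookkeeping -/

/-- Every coefficient of `P ∈ ℤ[X₁,…,X_m]` is bounded by the naive height `mvNatHeight P`.
[folklore] -/
theorem abs_coeff_le_mvNatHeight {m : ℕ} (P : MvPolynomial (Fin m) ℤ) (e : Fin m →₀ ℕ) :
    |P.coeff e| ≤ (mvNatHeight P : ℤ) := by
  by_cases he : e ∈ P.support
  · have h1 : (P.coeff e).natAbs ≤ mvNatHeight P := by
      unfold mvNatHeight
      exact Finset.le_sup (f := fun e => (P.coeff e).natAbs) he
    rw [← Int.natCast_natAbs]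
    exact_mod_cast h1
  · rw [MvPolynomial.notMem_support_iff.1 he, abs_zero]
    positivity

/-- `1 ≤ log 3` (`e ≤ 3`). [folklore] -/
theorem one_le_log_three : (1 : ℝ) ≤ Real.log 3 := by
  rw [Real.le_log_iff_exp_le (by norm_num)]
  have := Real.exp_one_lt_d9
  linarith

/-- ABLY'S SHAPE IS IN THE PENALTY CLASS: for `c₂ > 0`, `C > 0`, `D ≥ 1` and any real `L`,
`c₂ Dᵐ (L + exp(C Dᵐ log(D+1))) ≤ c₂ Dᵐ L + exp((|log c₂| + m + C) Dᵐ log(D+2))`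
(`log c₂ + m log D + C Dᵐ log(D+1) ≤ (|log c₂| + m + C) Dᵐ log(D+2)` using `log D ≤ D ≤ Dᵐ` and
`log(D+2) ≥ log 3 ≥ 1`). [folklore] -/
theorem ably_shape_le {c₂ C D : ℝ} (L : ℝ) {m : ℕ} (hm : 1 ≤ m) (hc₂ : 0 < c₂) (hC : 0 < C)
    (hD : 1 ≤ D) :
    c₂ * D ^ m * (L + Real.exp (C * D ^ m * Real.log (D + 1))) ≤
      c₂ * D ^ m * L + Real.exp ((|Real.log c₂| + m + C) * D ^ m * Real.log (D + 2)) := by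
  have hD0 : 0 < D := by linarith
  have hDm1 : 1 ≤ D ^ m := one_le_pow₀ hD
  have hDm0 : 0 < D ^ m := by linarith
  have hl3 : 1 ≤ Real.log (D + 2) := one_le_log_three.trans (Real.log_le_log (by norm_num) (by linarith))
  have hl0 : 0 ≤ Real.log (D + 2) := by linarith
  have hu1 : 1 ≤ D ^ m * Real.log (D + 2) := by nlinarith
  -- `log(c₂ Dᵐ e^{…}) ≤ (|log c₂| + m + C) Dᵐ log(D+2)`
  have h1 : Real.log c₂ ≤ |Real.log c₂| * (D ^ m * Real.log (D + 2)) := by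
    calc Real.log c₂ ≤ |Real.log c₂| := le_abs_self _
      _ = |Real.log c₂| * 1 := (mul_one _).symm
      _ ≤ |Real.log c₂| * (D ^ m * Real.log (D + 2)) :=
          mul_le_mul_of_nonneg_left hu1 (abs_nonneg _)
  have h2 : Real.log (D ^ m) ≤ (m : ℝ) * (D ^ m * Real.log (D + 2)) := by
    rw [Real.log_pow]
    have hlogD : Real.log D ≤ D := (Real.log_le_sub_one_of_pos hD0).trans (by linarith)
    have hDDm : D ≤ D ^ m := by
      calc D = D ^ 1 := (pow_one D).symm
        _ ≤ D ^ m := pow_le_pow_right₀ hD hm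
    have h3 : Real.log D ≤ D ^ m * Real.log (D + 2) := by nlinarith
    exact mul_le_mul_of_nonneg_left h3 (Nat.cast_nonneg m)
  have h3 : C * D ^ m * Real.log (D + 1) ≤ C * (D ^ m * Real.log (D + 2)) := by
    rw [mul_assoc]
    refine mul_le_mul_of_nonneg_left (mul_le_mul_of_nonneg_left ?_ hDm0.le) hC.le
    exact Real.log_le_log (by linarith) (by linarith)
  have hkey : c₂ * D ^ m * Real.exp (C * D ^ m * Real.log (D + 1)) ≤
      Real.exp ((|Real.log c₂| + m + C) * D ^ m * Real.log (D + 2)) := by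
    have e1 : c₂ * D ^ m * Real.exp (C * D ^ m * Real.log (D + 1)) =
        Real.exp (Real.log c₂ + Real.log (D ^ m) + C * D ^ m * Real.log (D + 1)) := by
      rw [Real.exp_add, Real.exp_add, Real.exp_log hc₂, Real.exp_log hDm0]
    rw [e1, Real.exp_le_exp]
    calc Real.log c₂ + Real.log (D ^ m) + C * D ^ m * Real.log (D + 1)
        ≤ |Real.log c₂| * (D ^ m * Real.log (D + 2)) + (m : ℝ) * (D ^ m * Real.log (D + 2)) +
          C * (D ^ m * Real.log (D + 2)) := by linarith
      _ = (|Real.log c₂| + m + C) * D ^ m * Real.log (D + 2) := by ring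
  calc c₂ * D ^ m * (L + Real.exp (C * D ^ m * Real.log (D + 1)))
      = c₂ * D ^ m * L + c₂ * D ^ m * Real.exp (C * D ^ m * Real.log (D + 1)) := by ring
    _ ≤ _ := by linarith [hkey]

end LWLayerPrinted

open LWLayerPrinted

/-! ## Stub 1 from the printed theorem -/

/-- **`LWPenaltyMeasure` (stub 1 of line `height-window-compactness`) from Ably's theorem**: for
`y ∈ ℚ̄ᵐ` with `ℚ`-linearly independent coordinates (`m ≥ 1`), the point `(e^{y₁},…,e^{y_m})`
carries a codimension-one measure with degree exponent `μ = m` in the Ably penalty class,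
`CodimOneMeasureX m (exp ∘ y) m κ c₂` with `κ = |log c₂| + m + C` — Ably's bound read at
`D = max 1 (deg P)`, `H = max 1 (height P)`. CONDITIONAL on the named fact
`Ably1994_lindemannWeierstrass_measure` (registered sub-goal `lwPenaltyMeasure_of_ably` of stub 1).
[cite: Ably1994, Théorème p. 30] -/
theorem lwPenaltyMeasure_of_ably :
    Literature.NumberTheory.Transcendental.Ably1994_lindemannWeierstrass_measure → LWPenaltyMeasure := by
  intro hA m y hm halg hli
  obtain ⟨C, c₂, hC, hc₂, hall⟩ := hA m y halg hli
  refine ⟨|Real.log c₂| + m + C, c₂, hc₂, fun P hP => ?_⟩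
  -- Ably at `D = max 1 (deg P)`, `H = max 1 (height P)`
  set Dn : ℕ := max 1 P.totalDegree with hDn
  set Hn : ℕ := max 1 (mvNatHeight P) with hHn
  have hdeg : P.totalDegree ≤ Dn := le_max_right _ _
  have hcoeff : ∀ e, |P.coeff e| ≤ (Hn : ℤ) := fun e =>
    (abs_coeff_le_mvNatHeight P e).trans (by rw [hHn]; exact_mod_cast le_max_right _ _)
  have hably := hall P Dn Hn hP hdeg hcoeff
  have hDcast : (max 1 (P.totalDegree : ℝ)) = (Dn : ℝ) := by rw [hDn, Nat.cast_max, Nat.cast_one]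
  have hHcast : (max 1 (mvNatHeight P : ℝ)) = (Hn : ℝ) := by rw [hHn, Nat.cast_max, Nat.cast_one]
  rw [hDcast, hHcast, Real.rpow_natCast]
  have hD1 : (1 : ℝ) ≤ Dn := by exact_mod_cast le_max_left 1 P.totalDegree
  have hH1 : (1 : ℝ) ≤ Hn := by exact_mod_cast le_max_left 1 (mvNatHeight P)
  have hshape := ably_shape_le (Real.log Hn) hm hc₂ hC hD1 (m := m)
  refine le_trans (Real.exp_le_exp.2 (neg_le_neg hshape)) ?_
  exact hably

/-! ## The penalty form of the crux at Lindemann–Weierstrass points (stubs 1–3) -/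

/-- **Penalty form at LW points from stub 1** (the skeleton's `approxTypePenAt_two_of_LW` with
stubs 2–3 DISCHARGED by the landed `stub_penaltyTransfer`, `stub_penaltySlotDichotomy_two`): at
`s ∈ ℚ̄²` with `ℚ`-linearly independent
coordinates, `LWPenaltyMeasure` at `m = 2` is `C⁺` with `μ = 2` at `(e^{s₁}, e^{s₂})`, at `m = 1`
it gives the floors `A = 1` at each `e^{sᵢ}`, the penalty transfer (landed stub 2) gives
`p = 3/2`, and the slot dichotomy (landed stub 3; `1 · 3/2 < 2`) gives `ApproxTypePenAt 2 s a κ C`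
with some `a < 1`. [folklore] -/
theorem approxTypePenAt_two_of_lwPenaltyMeasure (h₁ : LWPenaltyMeasure)
    (s : Fin 2 → ℂ) (halg : ∀ i, IsAlgebraic ℚ (s i)) (hli : LinearIndependent ℚ s) :
    ∃ a κ C : ℝ, a < 1 ∧ ApproxTypePenAt 2 s a κ C := by
  -- `C⁺` on the LW layer: the measure at `(e^{s₁}, e^{s₂})`
  obtain ⟨κ, C, hC⟩ := h₁ 2 s (by norm_num) halg hli
  -- the transfer in the penalty class (landed stub 2): `p = (2+1)/2`
  obtain ⟨κ', C', hP⟩ :=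
    stub_penaltyTransfer 2 (Complex.exp ∘ s) ((2 : ℕ) : ℝ) κ C (by norm_num) (by positivity) hC
  -- the floors at the two `y`-slots: the measure at `m = 1` at `e^{s i}`
  have hfloors : ∀ i : Fin 2, ∃ κ₁ C₁ : ℝ,
      SlotFloorX (Sum.elim s (Complex.exp ∘ s) (Sum.inr i)) ((1 : ℕ) : ℝ) κ₁ C₁ := by
    intro i
    have hli1 : LinearIndependent ℚ (fun _ : Fin 1 => s i) :=
      linearIndependent_unique_iff.2 (hli.ne_zero i)
    obtain ⟨κ₁, C₁, h⟩ := h₁ 1 (fun _ => s i) le_rfl (fun _ => halg i) hli1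
    exact ⟨κ₁, C₁, h⟩
  -- the slot dichotomy (landed stub 3) with `A = 1`, `p = 3/2`: `A p = 3/2 < 2 = A + 1`
  exact stub_penaltySlotDichotomy_two s Sum.inr _ _ C' ((1 : ℕ) : ℝ) Sum.inr_injective
    (by positivity) (by norm_num) (by norm_num) hP hfloors

/-! ## From the penalty form to the eventual typed bound -/

/-- The challenger clause forces `d ≥ 1` and `H ≥ 1`. [folklore] -/
theorem one_le_of_clause {α : ℂ} {d H : ℕ}
    (h : ∃ P : Polynomial ℤ, P ≠ 0 ∧ P.natDegree ≤ d ∧ (∀ k, |P.coeff k| ≤ (H : ℤ)) ∧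
      Polynomial.aeval α P = 0) : (1 : ℝ) ≤ d ∧ (1 : ℝ) ≤ H := by
  obtain ⟨P, hP0, hPdeg, hPH, hPα⟩ := h
  have hd1 : 1 ≤ d := (natDegree_pos_of_aeval_eq_zero hP0 hPα).1.trans_le hPdeg
  have hH1 : (1 : ℤ) ≤ H :=
    (Int.one_le_abs (leadingCoeff_ne_zero.2 hP0)).trans (hPH P.natDegree)
  exact ⟨by exact_mod_cast hd1, by exact_mod_cast hH1⟩

/-- **The typed bound ABOVE the threshold** `H ≥ exp(exp(κ d log(d+2)))` from the penalty form:
there `exp(κ d log(d+2)) ≤ log H ≤ d^{a⁺} log H`, so the penalty is absorbed by `C ↦ C + 1`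
(`a⁺ = max a 0`; any `b`). (The skeleton's `typed_above_of_pen`.) [folklore] -/
theorem typed_above_of_pen {s : Fin 2 → ℂ} {a κ C : ℝ} (h : ApproxTypePenAt 2 s a κ C) (b : ℝ)
    (d H : ℕ) (γ : Fin 2 ⊕ Fin 2 → ℂ)
    (hH : Real.exp (Real.exp (κ * d * Real.log ((d : ℝ) + 2))) ≤ (H : ℝ))
    (hfr : Module.finrank ℚ ↥(IntermediateField.adjoin ℚ (Set.range γ)) ≤ d)
    (hpoly : ∀ i, ∃ P : Polynomial ℤ, P ≠ 0 ∧ P.natDegree ≤ d ∧ (∀ k, |P.coeff k| ≤ (H : ℤ)) ∧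
      Polynomial.aeval (γ i) P = 0) :
    Real.exp (-((C + 1) * ((d : ℝ) ^ (max a 0) * Real.log H + (d : ℝ) ^ b))) ≤
      ‖γ - Sum.elim s (Complex.exp ∘ s)‖ := by
  obtain ⟨hC, hall⟩ := h
  obtain ⟨hd1, hH1⟩ := one_le_of_clause (hpoly (Sum.inl 0))
  have hd0 : (0 : ℝ) ≤ d := zero_le_one.trans hd1
  have hHpos : (0 : ℝ) < H := one_pos.trans_le hH1
  have hlogH : 0 ≤ Real.log H := Real.log_nonneg hH1
  set E : ℝ := Real.exp (κ * d * Real.log ((d : ℝ) + 2)) with hE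
  have hEL : E ≤ Real.log H := (Real.le_log_iff_exp_le hHpos).2 hH
  have hda : (d : ℝ) ^ a ≤ (d : ℝ) ^ (max a 0) := Real.rpow_le_rpow_of_exponent_le hd1 (le_max_left _ _)
  have hda1 : 1 ≤ (d : ℝ) ^ (max a 0) := Real.one_le_rpow hd1 (le_max_right _ _)
  have hdb : 0 ≤ (d : ℝ) ^ b := Real.rpow_nonneg hd0 _
  have key : C * (d : ℝ) ^ a * Real.log H + E ≤
      (C + 1) * ((d : ℝ) ^ (max a 0) * Real.log H + (d : ℝ) ^ b) := by
    have h1 : C * (d : ℝ) ^ a * Real.log H ≤ C * (d : ℝ) ^ (max a 0) * Real.log H := by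
      have := mul_le_mul_of_nonneg_right hda hlogH
      nlinarith [this, hC]
    have h2 : E ≤ (d : ℝ) ^ (max a 0) * Real.log H :=
      hEL.trans (le_mul_of_one_le_left hlogH hda1)
    nlinarith [h1, h2, hdb, hC, mul_nonneg (zero_le_one.trans hda1) hlogH]
  exact le_trans (Real.exp_le_exp.2 (neg_le_neg key)) (hall d H γ hfr hpoly)

/-- **The eventual typed bound from the penalty form**: `ApproxTypePenAt 2 s a κ C` with `a < 1`
gives the conclusion of `KhovanskiiApproxTypeEv` at the point `s` — witnesses
`(max a 0, 0, C + 1)` and the threshold `H₀(d) = ⌈exp(exp(κ d log(d+2)))⌉`. [folklore] -/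
theorem evAt_two_of_pen {s : Fin 2 → ℂ} {a κ C : ℝ} (h : ApproxTypePenAt 2 s a κ C) (ha : a < 1) :
    ∃ a' b C' : ℝ, a' < 1 ∧ 0 < C' ∧ ∀ d : ℕ, ∃ H₀ : ℕ, ∀ (H : ℕ) (γ : Fin 2 ⊕ Fin 2 → ℂ),
      H₀ ≤ H → Module.finrank ℚ ↥(IntermediateField.adjoin ℚ (Set.range γ)) ≤ d →
      (∀ i, ∃ P : Polynomial ℤ, P ≠ 0 ∧ P.natDegree ≤ d ∧ (∀ k, |P.coeff k| ≤ (H : ℤ)) ∧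
        Polynomial.aeval (γ i) P = 0) →
      Real.exp (-(C' * ((d : ℝ) ^ a' * Real.log H + (d : ℝ) ^ b))) ≤
        ‖γ - Sum.elim s (Complex.exp ∘ s)‖ := by
  have hC : 0 < C := h.1
  refine ⟨max a 0, 0, C + 1, max_lt ha one_pos, by linarith, fun d => ?_⟩
  refine ⟨⌈Real.exp (Real.exp (κ * d * Real.log ((d : ℝ) + 2)))⌉₊, fun H γ hH₀ hfr hpoly => ?_⟩
  have hH : Real.exp (Real.exp (κ * d * Real.log ((d : ℝ) + 2))) ≤ (H : ℝ) :=
    (Nat.le_ceil _).trans (by exact_mod_cast hH₀)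
  exact typed_above_of_pen h 0 d H γ hH hfr hpoly

/-! ## The Lindemann–Weierstrass layer of `KhovanskiiApproxTypeEv` at `n = 2` -/

/-- **The `n = 2` LW layer of the eventual crux from stub 1**: `LWPenaltyMeasure` (with the landed
stubs 2–3) gives, at every `s ∈ ℚ̄²` with `ℚ`-linearly independent coordinates, the conclusion of
`KhovanskiiApproxTypeEv` (`a < 1 = 1/(n−1)`, eventual in the height). [folklore] -/
theorem evLW_two_of_lwPenaltyMeasure (h₁ : LWPenaltyMeasure) (s : Fin 2 → ℂ)
    (halg : ∀ i, IsAlgebraic ℚ (s i)) (hli : LinearIndependent ℚ s) :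
    ∃ a b C : ℝ, a < 1 ∧ 0 < C ∧ ∀ d : ℕ, ∃ H₀ : ℕ, ∀ (H : ℕ) (γ : Fin 2 ⊕ Fin 2 → ℂ),
      H₀ ≤ H → Module.finrank ℚ ↥(IntermediateField.adjoin ℚ (Set.range γ)) ≤ d →
      (∀ i, ∃ P : Polynomial ℤ, P ≠ 0 ∧ P.natDegree ≤ d ∧ (∀ k, |P.coeff k| ≤ (H : ℤ)) ∧
        Polynomial.aeval (γ i) P = 0) →
      Real.exp (-(C * ((d : ℝ) ^ a * Real.log H + (d : ℝ) ^ b))) ≤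
        ‖γ - Sum.elim s (Complex.exp ∘ s)‖ := by
  obtain ⟨a, κ, C, ha, hpen⟩ := approxTypePenAt_two_of_lwPenaltyMeasure h₁ s halg hli
  exact evAt_two_of_pen hpen ha

/-- **The `n = 2` Lindemann–Weierstrass layer of `KhovanskiiApproxTypeEv` from Ably's theorem**:
CONDITIONAL ONLY on the named fact `Ably1994_lindemannWeierstrass_measure` (Ably 1994, Théorème
p. 30), every `s ∈ ℚ̄²` with `ℚ`-linearly independent coordinates satisfies the conclusion of the
route's load-bearing crux `KhovanskiiApproxTypeEv` (stmt-Schanuel-14972):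
`∃ a < 1, b, C > 0, ∀ d ∃ H₀ ∀ H ≥ H₀, ‖γ − (s, e^s)‖ ≥ exp(−C(dᵃ log H + dᵇ))` for all
algebraic challengers `γ` of level `(d, H)`. [cite: Ably1994, Théorème p. 30] -/
theorem evLW_two_of_ably (hA : Ably1994_lindemannWeierstrass_measure)
    (s : Fin 2 → ℂ) (halg : ∀ i, IsAlgebraic ℚ (s i)) (hli : LinearIndependent ℚ s) :
    ∃ a b C : ℝ, a < 1 ∧ 0 < C ∧ ∀ d : ℕ, ∃ H₀ : ℕ, ∀ (H : ℕ) (γ : Fin 2 ⊕ Fin 2 → ℂ),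
      H₀ ≤ H → Module.finrank ℚ ↥(IntermediateField.adjoin ℚ (Set.range γ)) ≤ d →
      (∀ i, ∃ P : Polynomial ℤ, P ≠ 0 ∧ P.natDegree ≤ d ∧ (∀ k, |P.coeff k| ≤ (H : ℤ)) ∧
        Polynomial.aeval (γ i) P = 0) →
      Real.exp (-(C * ((d : ℝ) ^ a * Real.log H + (d : ℝ) ^ b))) ≤
        ‖γ - Sum.elim s (Complex.exp ∘ s)‖ :=
  evLW_two_of_lwPenaltyMeasure (lwPenaltyMeasure_of_ably hA) s halg hli

end Summit.Schanuel.Schanuel.Cruxes.KhovanskiiApproxType.HeightWindowCompactness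

end
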